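import Summits.HodgeConjecture.HodgeConjecture.Theorems.AnchorTransportAnchorExistenceSplit
import Summits.HodgeConjecture.HodgeConjecture.Theorems.AnchorTransportAnchorExistenceFloor
import Literature.AlgebraicGeometry.HodgeTheory.HodgeIndexSurface
import Literature.AlgebraicGeometry.HodgeTheory.SupportedClassesHodgeConiveau
import Literature.AlgebraicGeometry.Surfaces.K3BettiNumbers
import Literature.AlgebraicGeometry.Surfaces.K3Marking
import Literature.AlgebraicGeometry.HodgeTheory.GlobalInvariantCycles
import Literature.AlgebraicGeometry.HodgeTheory.SemiregularVariationalHodgeProofs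
import Literature.AlgebraicGeometry.HodgeTheory.HodgeIndexPrimitiveAlgebraicHolds
import Literature.AlgebraicGeometry.HodgeTheory.SupportedClassesHodgeConiveauHolds
import Literature.AlgebraicGeometry.HodgeTheory.InvariantClassesFromTotalSpaceHolds
import Literature.AlgebraicGeometry.Surfaces.K3LatticeInvariantsHolds
import Literature.AlgebraicGeometry.Surfaces.K3SurfaceBuskinLeaves
import Literature.AlgebraicGeometry.Surfaces.K3LatticeInvariantsSignatureProofs
import Literature.AlgebraicGeometry.Surfaces.K3HodgeTypesHolds
import Literature.AlgebraicGeometry.HodgeTheory.HodgeFiltrationModelsReductionProofs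
import Summits.HodgeConjecture.HodgeConjecture.Theorems.AnchorTransportAnchorExistenceK3SquareRatEndFloor
import Summits.HodgeConjecture.HodgeConjecture.Theorems.AnchorTransportAnchorExistenceK3SquareCMFloor
import HarnessLib

/-!
# Route AnchorTransport — `AnchorExistence` (item stmt-HodgeConjecture-1077): the K3-square sector assembled from its leaves

The K3-square sector of the crux (hypothesis `hK3` of the split
`anchorExistence_of_k3Square_of_offK3Square`): every rational `(2,2)`-class `c` on `S ⊗ S`, `S` a
projective K3 surface, is anchored. This file proves it FROM ITS LEAVES, all spelled out as
hypotheses, by the case analysis on the endomorphism field `K = End_Hdg(T(S)_ℚ)` (Zarhin: `ℚ`, CM,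
or totally real):

* `K = ℚ` — the class is algebraic on `S ⊗ S` itself (landed floor
  `anchorExistence_k3Square_floor_of_ratEnd`, p97645): constant family;
* `S` CM — algebraic on `S ⊗ S` itself by Buskin's corollary derived from his Thm. 1.1 (landed floor
  `anchorExistence_k3Square_floor_of_CM`, p113529): constant family;
* real multiplication — hypothesis `hRM`, the GEOGRAPHY statement (a smooth projective family of
  fourfolds over a smooth irreducible quasi-projective base through `S ⊗ S`, a CONTINUOUS family of
  fibrewise rational `(2,2)` classes through `c`, and a fibre `S₀ ⊗ S₀` with `S₀` a CM K3 surface; in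
  print the fibre square of the universal family over the `(NS(S), K)`-polarised orthogonal Shimura
  variety, van Geemen 2008 §3, CM points dense), turned into an anchor by
  `anchorExistence_exists_totalClass_of_continuous` — **a continuous section of `R⁴ f_* ℂ` over a
  smooth irreducible quasi-projective base with quasi-projective total space is the restriction of
  ONE class of the total space** (Deligne 1968 / Voisin II Thm. 4.18, the tree's theorem
  `deligne1968_invariantClass_fromTotalSpace_holds`, at one point, plus the identity principle for
  continuous sections of the local system, `eq_map_fiberι_of_continuous_of_eq_at`) — and anchored at
  the CM floor of `S₀ ⊗ S₀` (`anchorTransport_anchor_of_floor`).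

The named facts the two floors consume enter as hypotheses — `K3_finrank_complexBetti_two`
(`b₂ = 22`, the one undischarged input of the K3 marking `Huybrechts_K3_marking_exists_holds_of`),
`Huybrechts_K3_oddBetti_vanish`, and the three undischarged leaves of Buskin's Thm. 1.1
(`Buskin2019_hodgeIsometry_algebraic_holds_of`): `Buskin2019_reflectiveHodgeIsometry_algebraic`,
`cupProduct_mem_algebraicClasses_tripleProduct_surfaces`, `Huybrechts_K3_periodSurjective_projective`
— next to the tree's theorems `lefschetzOneOne_rational_holds`, `hodgeIndex_surface_holds`,
`Grothendieck1969_supportedClasses_le_hodgeConiveau_holds`, `K3_even_intersectionForm_holds`, ….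
Composed with the split, `anchorExistence_of_leaves` is the crux from: five named facts, the RM
geography statement, and the off-K3-square sector (kernel-checked; the line skeleton
`Cruxes/AnchorExistence/Lines/Sketch.lean` made importable).
-/

noncomputable section

set_option linter.dupNamespace false

open CategoryTheory AlgebraicGeometry MonoidalCategory
open Literature.AlgebraicGeometry Literature.AlgebraicGeometry.Motives
  Literature.AlgebraicGeometry.HodgeTheory Literature.AlgebraicGeometry.Surfaces
  Literature.AlgebraicTopology.SingularHomology

namespace Summit.HodgeConjecture.HodgeConjecture.Theorems

open Summit.HodgeConjecture.HodgeConjecture.Theses.AnchorTransport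

/-- **A continuous family of fibre classes comes from ONE class of the total space.** Let
`f : 𝒳 ⟶ B` be a smooth projective family with `𝒳` and `B` quasi-projective over `ℂ`, `B` smooth and
irreducible, and `w` a family of classes `w s ∈ Hᵏ(𝒳_s(ℂ); ℂ)` which is continuous as a section of
the espace étalé `FiberClass f k` of `Rᵏ f_* ℂ`. Then `w s = A|_{𝒳_s}` for every `s`, for one class
`A ∈ Hᵏ(𝒳(ℂ); ℂ)`: Deligne 1968 / Voisin II Thm. 4.18 (`deligne1968_invariantClass_fromTotalSpace_holds`)
gives `A` with `w s₁ = A|_{𝒳_{s₁}}` at one point, and two continuous sections of the local system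
`Rᵏ f_* ℂ` (Ehresmann, `isCohomologicallyLocallyTrivialOn_univ_of_isSmoothProjectiveFamily`) over the
connected manifold `B(ℂ)` (`ComplexPoints.connectedSpace_iff_holds`) that agree at one point agree
everywhere (`eq_map_fiberι_of_continuous_of_eq_at`, Voisin II Lemma 4.17).
[cite: VoisinHodgeII2003, Thm. 4.18 and Lemma 4.17] [cite: Deligne1968, Prop. (2.1) with (2.6.3)] -/
theorem anchorExistence_exists_totalClass_of_continuous {𝒳 B : SchemeOver ℂ} (f : 𝒳 ⟶ B) {n : ℕ}
    (hf : IsSmoothProjectiveFamily f n) (hq𝒳 : IsQuasiProjectiveOver 𝒳) (hqp : IsQuasiProjectiveOver B)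
    (hirr : IrreducibleSpace B.left) (hsm : AlgebraicGeometry.Smooth B.hom) (k : ℕ)
    (w : ∀ s : ComplexPoints B, complexBetti (fiberOver f s) k)
    (hwc : Continuous fun s => (⟨s, w s⟩ : FiberClass f k)) :
    ∃ A : complexBetti 𝒳 k, ∀ s, w s = complexBetti.map (fiberι f s) k A := by
  haveI := hsm
  haveI := hirr
  haveI : LocallyOfFiniteType B.hom := hqp.locallyOfFiniteType
  haveI : ConnectedSpace (ComplexPoints B) := (ComplexPoints.connectedSpace_iff_holds B).2 inferInstance
  obtain ⟨s₁⟩ := (inferInstance : Nonempty (ComplexPoints B))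
  -- invariant classes come from the total space (Deligne 1968), at `s₁`: `w s₁ = A|_{𝒳_{s₁}}`
  obtain ⟨A, hA⟩ := deligne1968_invariantClass_fromTotalSpace_holds 𝒳 B f n hf hq𝒳 hqp hsm k
    (fun s => (⟨s, w s⟩ : FiberClass f k)) hwc (fun _ => rfl) s₁
  have hw₁ : w s₁ = complexBetti.map (fiberι f s₁) k A := by
    change (⟨s₁, w s₁⟩ : FiberClass f k) = ⟨s₁, complexBetti.map (fiberι f s₁) k A⟩ at hA
    simp only [FiberClass.mk.injEq, heq_eq_eq, true_and] at hA
    exact hA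
  -- identity principle over the connected base `B(ℂ)`
  obtain ⟨d, hd⟩ := exists_smoothOfRelativeDimension_of_connectedSpace_complexPoints B
  haveI := hd
  haveI := pathConnectedSpace_complexPoints_of_smoothOfRelativeDimension B d
  have hU := isCohomologicallyLocallyTrivialOn_univ_of_isSmoothProjectiveFamily f d hf hqp
  exact ⟨A, eq_map_fiberι_of_continuous_of_eq_at f k hU w hwc A hw₁⟩

/-- **A flat-section family anchors the K3 square at a CM floor** (the real-multiplication glue of
the sector, per pair `(S, c)`). If `S ⊗ S ≅ 𝒳_{s₁}` sits in a smooth projective family `f : 𝒳 ⟶ B` of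
fourfolds with `𝒳`, `B` quasi-projective, `B` smooth irreducible, carrying a continuous family `w` of
fibrewise rational `(2,2)` classes through `c`, with a fibre `𝒳_{s₀} ≅ S₀ ⊗ S₀`, then `(S ⊗ S, c)` has
the anchoring data of `AnchorExistence` with a global class `A` (`anchorExistence_exists_totalClass_of_continuous`)
and the same distinguished fibre. [cite: VoisinHodgeII2003, Thm. 4.18] [cite: vanGeemen2008RealMultK3, §3] -/
theorem anchorExistence_k3Square_anchor_of_flatSection {S S₀ 𝒳 B : SchemeOver ℂ} (f : 𝒳 ⟶ B)
    (s₁ s₀ : ComplexPoints B) (e : S ⊗ S ≅ fiberOver f s₁) (e₀ : fiberOver f s₀ ≅ S₀ ⊗ S₀)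
    (w : ∀ s : ComplexPoints B, complexBetti (fiberOver f s) (2 * 2)) {c : complexBetti (S ⊗ S) (2 * 2)}
    (hf : IsSmoothProjectiveFamily f 4) (hirr : IrreducibleSpace B.left) (hsm : AlgebraicGeometry.Smooth B.hom)
    (hqp : IsQuasiProjectiveOver B) (hq𝒳 : IsQuasiProjectiveOver 𝒳)
    (hwc : Continuous fun s => (⟨s, w s⟩ : FiberClass f (2 * 2)))
    (hw : ∀ s : ComplexPoints B, IsRationalClass (w s) ∧ IsOfHodgeType 4 (fiberOver f s) (2 * 2) 2 2 (w s))
    (hws₁ : complexBetti.map e.hom (2 * 2) (w s₁) = c) :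
    ∃ (A : complexBetti 𝒳 (2 * 2)) (_e₀ : fiberOver f s₀ ≅ S₀ ⊗ S₀),
      IsSmoothProjectiveFamily f 4 ∧ IrreducibleSpace B.left ∧ AlgebraicGeometry.Smooth B.hom ∧
      (∀ s : ComplexPoints B, IsRationalClass (complexBetti.map (fiberι f s) (2 * 2) A) ∧
        IsOfHodgeType 4 (fiberOver f s) (2 * 2) 2 2 (complexBetti.map (fiberι f s) (2 * 2) A)) ∧
      complexBetti.map e.hom (2 * 2) (complexBetti.map (fiberι f s₁) (2 * 2) A) = c := by
  obtain ⟨A, hwall⟩ := anchorExistence_exists_totalClass_of_continuous f hf hq𝒳 hqp hirr hsm (2 * 2) w hwc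
  refine ⟨A, e₀, hf, hirr, hsm, fun s => ?_, ?_⟩
  · rw [← hwall s]
    exact hw s
  · rw [← hwall s₁]
    exact hws₁

/-- **The K3-square sector from its leaves.** HYPOTHESES: the five undischarged named facts the two
floors consume — `b₂(S) = 22` (`K3_finrank_complexBetti_two`, feeding the marking
`Huybrechts_K3_marking_exists_holds_of`), the vanishing of the odd Betti numbers
(`Huybrechts_K3_oddBetti_vanish`), and the three leaves of Buskin's Thm. 1.1
(`Buskin2019_hodgeIsometry_algebraic_holds_of`: Prop. 6.2 for reflective isometries, cup products of
algebraic classes on triple products of surfaces, surjectivity of the period map) — and (`hRM`) the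
real-multiplication geography: for `S` with `End_Hdg(T(S)_ℚ) ≠ ℚ` and not CM, every rational `(2,2)`
class on `S ⊗ S` sits in a continuous family of fibrewise rational `(2,2)` classes over a smooth
projective family of fourfolds (quasi-projective total space, smooth irreducible quasi-projective
base) through `S ⊗ S` with a fibre `S₀ ⊗ S₀`, `S₀` a CM K3 surface. CONCLUSION: every rational
`(2,2)`-class on `S ⊗ S` is anchored — `K = ℚ` and CM by the landed floors and the constant family
(`anchorTransport_anchor_of_mem_algebraicClasses`), real multiplication by
`anchorExistence_k3Square_anchor_of_flatSection` anchored at the CM floor of `S₀ ⊗ S₀`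
(`anchorTransport_anchor_of_floor`). [cite: Huybrechts2019, Cor. 0.4 (ii)] [cite: Buskin2019, Thm. 1.1]
[cite: vanGeemen2008RealMultK3, §3] [cite: Huybrechts2016K3, Ch. 1 §3.3 and Ch. 3 Thm. 3.7 (Zarhin)] -/
theorem anchorExistence_k3SquareSector_of_leaves (hb₂ : K3_finrank_complexBetti_two)
    (hodd : Huybrechts_K3_oddBetti_vanish) (hrefl : Buskin2019_reflectiveHodgeIsometry_algebraic)
    (hcup : cupProduct_mem_algebraicClasses_tripleProduct_surfaces)
    (hper : Huybrechts_K3_periodSurjective_projective)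
    (hRM : ∀ S : SchemeOver ℂ, IsK3Surface S →
      ¬ (∀ f : complexBetti S (2 * 1) →ₗ[ℂ] complexBetti S (2 * 1),
        (∀ x, IsRationalClass x → IsRationalClass (f x)) →
        (∀ (i j : ℕ) x, IsOfHodgeType 2 S (2 * 1) i j x → IsOfHodgeType 2 S (2 * 1) i j (f x)) →
        (∀ d ∈ algebraicClasses S 1, f d = 0) →
        (∀ x : complexBetti S (2 * 1), ∀ d ∈ algebraicClasses S 1,
          cupProduct (rfl : 2 * 1 + 2 * 1 = 2 * 2) (f x) d = 0) →
        ∃ a : ℚ, ∀ x : complexBetti S (2 * 1),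
          (∀ d ∈ algebraicClasses S 1, cupProduct (rfl : 2 * 1 + 2 * 1 = 2 * 2) x d = 0) →
          f x = (a : ℂ) • x) →
      ¬ HasComplexMultiplication S →
      ∀ c : complexBetti (S ⊗ S) (2 * 2), IsRationalClass c → IsOfHodgeType 4 (S ⊗ S) (2 * 2) 2 2 c →
      ∃ (𝒳 B : SchemeOver ℂ) (f : 𝒳 ⟶ B) (s₁ s₀ : ComplexPoints B)
        (e : S ⊗ S ≅ fiberOver f s₁) (S₀ : SchemeOver ℂ) (_e₀ : fiberOver f s₀ ≅ S₀ ⊗ S₀)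
        (w : ∀ s : ComplexPoints B, complexBetti (fiberOver f s) (2 * 2)),
        IsSmoothProjectiveFamily f 4 ∧ IrreducibleSpace B.left ∧ AlgebraicGeometry.Smooth B.hom ∧
        IsQuasiProjectiveOver B ∧ IsQuasiProjectiveOver 𝒳 ∧
        (Continuous fun s => (⟨s, w s⟩ : FiberClass f (2 * 2))) ∧
        (∀ s : ComplexPoints B, IsRationalClass (w s) ∧ IsOfHodgeType 4 (fiberOver f s) (2 * 2) 2 2 (w s)) ∧
        complexBetti.map e.hom (2 * 2) (w s₁) = c ∧
        IsK3Surface S₀ ∧ HasComplexMultiplication S₀) :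
    ∀ S : SchemeOver ℂ, IsK3Surface S →
      ∀ c : complexBetti (S ⊗ S) (2 * 2), IsRationalClass c → IsOfHodgeType 4 (S ⊗ S) (2 * 2) 2 2 c →
      ∃ (𝒳 B : SchemeOver ℂ) (f : 𝒳 ⟶ B) (s₁ s₀ : ComplexPoints B) (e : S ⊗ S ≅ fiberOver f s₁)
        (A : complexBetti 𝒳 (2 * 2)),
        IsSmoothProjectiveFamily f 4 ∧ IrreducibleSpace B.left ∧ AlgebraicGeometry.Smooth B.hom ∧
        (∀ s : ComplexPoints B, IsRationalClass (complexBetti.map (fiberι f s) (2 * 2) A) ∧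
          IsOfHodgeType 4 (fiberOver f s) (2 * 2) 2 2 (complexBetti.map (fiberι f s) (2 * 2) A)) ∧
        complexBetti.map e.hom (2 * 2) (complexBetti.map (fiberι f s₁) (2 * 2) A) = c ∧
        complexBetti.map (fiberι f s₀) (2 * 2) A ∈ algebraicClasses (fiberOver f s₀) 2 := by
  intro S hS c hc hpp
  have hSS : IsSmoothProjective 4 (S ⊗ S) := hS.isSmoothProjective_tensor_self
  -- the K3 marking from `b₂ = 22` and the tree's theorems
  have hmark : Huybrechts_K3_marking_exists :=
    Huybrechts_K3_marking_exists_holds_of hb₂ K3_even_intersectionForm_holds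
      (K3_exists_orientation_signature_hodgeRiemann_ample_of_finrank_complexBetti_two hb₂)
      (fun E _ _ _ M _ _ => HodgeTheory.Voisin2002_closedForm_top_zero_not_exact_holds E M)
      Huybrechts_K3_hodgeTypes_H2_holds HodgeTheory.hodgePQ_independent_of_hodgeModel_holds
      (fun E _ _ _ => Literature.NumberTheory.Transcendental.exists_deRhamIsoFamily_holds E)
  -- Buskin's Thm. 1.1 from its three leaves and the marking
  have hB : Buskin2019_hodgeIsometry_algebraic :=
    Buskin2019_hodgeIsometry_algebraic_holds_of hrefl hcup hper hmark
  have hG := Grothendieck1969_supportedClasses_le_hodgeConiveau_holds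
  have hHI : ∀ S' : SchemeOver ℂ, hodgeIndex_surface S' := fun _ => hodgeIndex_surface_holds
  -- the CM floor (Buskin's corollary from Thm. 1.1), used on `S` itself or on the anchor fibre
  have hfloor : ∀ S' : SchemeOver ℂ, IsK3Surface S' → HasComplexMultiplication S' →
      ∀ c' : complexBetti (S' ⊗ S') (2 * 2), IsRationalClass c' →
        IsOfHodgeType 4 (S' ⊗ S') (2 * 2) 2 2 c' → c' ∈ algebraicClasses (S' ⊗ S') 2 :=
    anchorExistence_k3Square_floor_of_CM hB lefschetzOneOne_rational_holds hmark hG hodd hHI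
  by_cases hQ : ∀ f : complexBetti S (2 * 1) →ₗ[ℂ] complexBetti S (2 * 1),
      (∀ x, IsRationalClass x → IsRationalClass (f x)) →
      (∀ (i j : ℕ) x, IsOfHodgeType 2 S (2 * 1) i j x → IsOfHodgeType 2 S (2 * 1) i j (f x)) →
      (∀ d ∈ algebraicClasses S 1, f d = 0) →
      (∀ x : complexBetti S (2 * 1), ∀ d ∈ algebraicClasses S 1,
        cupProduct (rfl : 2 * 1 + 2 * 1 = 2 * 2) (f x) d = 0) →
      ∃ a : ℚ, ∀ x : complexBetti S (2 * 1),
        (∀ d ∈ algebraicClasses S 1, cupProduct (rfl : 2 * 1 + 2 * 1 = 2 * 2) x d = 0) →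
        f x = (a : ℂ) • x
  · -- `End_Hdg(T) = ℚ`: the class is algebraic on `S ⊗ S` itself; constant family
    exact anchorTransport_anchor_of_mem_algebraicClasses hSS 2 c hc hpp
      (anchorExistence_k3Square_floor_of_ratEnd lefschetzOneOne_rational_holds hmark hG hodd hHI
        S hS hQ c hc hpp)
  by_cases hCM : HasComplexMultiplication S
  · -- CM: the class is algebraic on `S ⊗ S` itself; constant family
    exact anchorTransport_anchor_of_mem_algebraicClasses hSS 2 c hc hpp (hfloor S hS hCM c hc hpp)
  · -- real multiplication: CM-anchored family, CM floor at the anchor fibre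
    obtain ⟨𝒳, B, f, s₁, s₀, e, S₀, e₀, w, hf, hirr, hsm, hqp, hq𝒳, hwc, hw, hws₁, hS₀, hCM₀⟩ :=
      hRM S hS hQ hCM c hc hpp
    obtain ⟨A, e₀', hf', hirr', hsm', hfib, hAc⟩ :=
      anchorExistence_k3Square_anchor_of_flatSection f s₁ s₀ e e₀ w hf hirr hsm hqp hq𝒳 hwc hw hws₁
    exact anchorTransport_anchor_of_floor f s₁ s₀ e A hf' hirr' hsm' hfib hAc e₀'
      fun c₀ hc₀ hpp₀ => hfloor S₀ hS₀ hCM₀ c₀ hc₀ hpp₀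

/-- **`AnchorExistence` from the leaves of line `Sketch`** (the whole lead skeleton, importable):
the five named facts of the K3-square floors, the real-multiplication geography statement `hRM`, and
the off-K3-square sector `hoff` (middle range, non-algebraic classes: the anchor geography of the
Hodge loci there, HC-sandwiched) give the crux BY NAME, through
`anchorExistence_k3SquareSector_of_leaves` and the split `anchorExistence_of_k3Square_of_offK3Square`.
[cite: Deligne2000, §1] [cite: Huybrechts2019, Cor. 0.4 (ii)] [cite: vanGeemen2008RealMultK3, §3] -/
theorem anchorExistence_of_leaves :
    K3_finrank_complexBetti_two → Huybrechts_K3_oddBetti_vanish →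
    Buskin2019_reflectiveHodgeIsometry_algebraic → cupProduct_mem_algebraicClasses_tripleProduct_surfaces →
    Huybrechts_K3_periodSurjective_projective →
    (∀ S : SchemeOver ℂ, IsK3Surface S →
      ¬ (∀ f : complexBetti S (2 * 1) →ₗ[ℂ] complexBetti S (2 * 1),
        (∀ x, IsRationalClass x → IsRationalClass (f x)) →
        (∀ (i j : ℕ) x, IsOfHodgeType 2 S (2 * 1) i j x → IsOfHodgeType 2 S (2 * 1) i j (f x)) →
        (∀ d ∈ algebraicClasses S 1, f d = 0) →
        (∀ x : complexBetti S (2 * 1), ∀ d ∈ algebraicClasses S 1,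
          cupProduct (rfl : 2 * 1 + 2 * 1 = 2 * 2) (f x) d = 0) →
        ∃ a : ℚ, ∀ x : complexBetti S (2 * 1),
          (∀ d ∈ algebraicClasses S 1, cupProduct (rfl : 2 * 1 + 2 * 1 = 2 * 2) x d = 0) →
          f x = (a : ℂ) • x) →
      ¬ HasComplexMultiplication S →
      ∀ c : complexBetti (S ⊗ S) (2 * 2), IsRationalClass c → IsOfHodgeType 4 (S ⊗ S) (2 * 2) 2 2 c →
      ∃ (𝒳 B : SchemeOver ℂ) (f : 𝒳 ⟶ B) (s₁ s₀ : ComplexPoints B)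
        (e : S ⊗ S ≅ fiberOver f s₁) (S₀ : SchemeOver ℂ) (_e₀ : fiberOver f s₀ ≅ S₀ ⊗ S₀)
        (w : ∀ s : ComplexPoints B, complexBetti (fiberOver f s) (2 * 2)),
        IsSmoothProjectiveFamily f 4 ∧ IrreducibleSpace B.left ∧ AlgebraicGeometry.Smooth B.hom ∧
        IsQuasiProjectiveOver B ∧ IsQuasiProjectiveOver 𝒳 ∧
        (Continuous fun s => (⟨s, w s⟩ : FiberClass f (2 * 2))) ∧
        (∀ s : ComplexPoints B, IsRationalClass (w s) ∧ IsOfHodgeType 4 (fiberOver f s) (2 * 2) 2 2 (w s)) ∧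
        complexBetti.map e.hom (2 * 2) (w s₁) = c ∧
        IsK3Surface S₀ ∧ HasComplexMultiplication S₀) →
    (∀ ⦃n : ℕ⦄ ⦃X : SchemeOver ℂ⦄, IsSmoothProjective n X →
      (∀ S : SchemeOver ℂ, IsK3Surface S → IsEmpty (X ≅ S ⊗ S)) →
      ∀ (p : ℕ), 2 ≤ p → p + 2 ≤ n →
      ∀ (c : complexBetti X (2 * p)), IsRationalClass c → IsOfHodgeType n X (2 * p) p p c →
      c ∉ algebraicClasses X p →
      ∃ (𝒳 S : SchemeOver ℂ) (f : 𝒳 ⟶ S) (s₁ s₀ : ComplexPoints S) (e : X ≅ fiberOver f s₁)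
        (A : complexBetti 𝒳 (2 * p)),
        IsSmoothProjectiveFamily f n ∧ IrreducibleSpace S.left ∧ AlgebraicGeometry.Smooth S.hom ∧
        (∀ s : ComplexPoints S, IsRationalClass (complexBetti.map (fiberι f s) (2 * p) A) ∧
          IsOfHodgeType n (fiberOver f s) (2 * p) p p (complexBetti.map (fiberι f s) (2 * p) A)) ∧
        complexBetti.map e.hom (2 * p) (complexBetti.map (fiberι f s₁) (2 * p) A) = c ∧
        complexBetti.map (fiberι f s₀) (2 * p) A ∈ algebraicClasses (fiberOver f s₀) p) →
    AnchorExistence :=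
  fun hb₂ hodd hrefl hcup hper hRM hoff =>
  anchorExistence_of_k3Square_of_offK3Square
    (anchorExistence_k3SquareSector_of_leaves hb₂ hodd hrefl hcup hper hRM) hoff

end Summit.HodgeConjecture.HodgeConjecture.Theorems

end
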